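import Mathlib
import Literature.Computability.QuantumComplexity.F2PolynomialFourierTailsLevelKProofs

/-!
# The stencil (Delsarte-type) certificate for grid label bounds

Solo-informed MatrixMultiplication, gen 88 (CLAIMS c672; `work/g87/cyc/CYC.md` §9 (i)–(j)).

In the common-quotient regime of the uniform volume conjecture `(PT)` the blocks of an aligned design carry finite
label sets `A_t ⊆ Λ` (`Λ` a finite abelian group; in the application `Λ = 𝔽₂^q`) subject to *forbidden differences*:
`x - y ∉ F_{tu}` for `x ∈ A_t`, `y ∈ A_u`, `t ≠ u`.  The conjectured GRID LABEL BOUND is `Σ_t |A_t| ≤ |Λ|`.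
All certificates found so far (translate packings, and numerically the Schrijver `ϑ′`-bound, which is tight for every
computed pattern except the generic `K_{3,3}`) are instances of ONE elementary inequality, proved here in full
generality:

* `sum_card_le_card_of_stencils` — let `ν t r : Λ → ℝ` (`t` a block, `r` an auxiliary coordinate) satisfy
  (1) `Σ_z ν t r z = e r` for a fixed unit vector `e` (`Σ_r (e r)^2 = 1`),
  (2) the contraction property on the block itself: `Σ_r Σ_x (Σ_{y ∈ A_t} ν t r (x - y))^2 ≤ |A_t|`
      (implied by `Σ_r |ν̂ t r (s)|² ≤ 1` for every character `s`),
  (3) non-positive correlation across blocks at every realised difference: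
      `Σ_r Σ_w ν t r w · ν u r (w + (y - y')) ≤ 0` for `t ≠ u`, `y ∈ A_t`, `y' ∈ A_u`.
  Then `Σ_t |A_t| ≤ |Λ|`.

Proof (Cauchy–Schwarz, as in Delsarte's linear-programming bound): put `Φ r x = Σ_t Σ_{y ∈ A_t} ν t r (x - y)`.
By (1), `Σ_x Φ r x = S · e r` with `S = Σ_t |A_t|`, so `S² = Σ_r (Σ_x Φ r x)² ≤ |Λ| Σ_r Σ_x (Φ r x)²`; expanding the
square, the diagonal block terms are `≤ |A_t|` by (2) and the cross terms are `≤ 0` by (3) after the substitution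
`w = x - y`.  Hence `S² ≤ |Λ| S`.  Translate packings are the case of one coordinate and point masses `ν t = δ_{σ_t}`.
Elementary; no `sorry` (the fourfold reordering `CHHL2018.sum_comm4` is reused from the Literature tree).
-/

namespace Summit.MatrixMultiplication.MatrixMultiplication.Theorems.SoloVal

open Finset

section Stencil

variable {G : Type*} [AddCommGroup G] [Fintype G]
variable {T : Type*} [Fintype T] [DecidableEq T]
variable {R : Type*} [Fintype R]

/-- Translation invariance of a full sum over a finite abelian group. -/
theorem sum_sub_right_eq (h : G → ℝ) (y : G) : ∑ x, h (x - y) = ∑ z, h z :=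
  Fintype.sum_equiv (Equiv.subRight y) (fun x => h (x - y)) h (fun _ => rfl)

/-- **Stencil certificate (Delsarte-type bound).**  See the module docstring. -/
theorem sum_card_le_card_of_stencils (A : T → Finset G) (ν : T → R → G → ℝ) (e : R → ℝ)
    (he : ∑ r, e r ^ 2 = 1)
    (h1 : ∀ t r, ∑ z, ν t r z = e r)
    (h2 : ∀ t, ∑ r, ∑ x, (∑ y ∈ A t, ν t r (x - y)) ^ 2 ≤ ((A t).card : ℝ))
    (h3 : ∀ t u, t ≠ u → ∀ y ∈ A t, ∀ y' ∈ A u,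
      ∑ r, ∑ w, ν t r w * ν u r (w + (y - y')) ≤ 0) :
    (∑ t, ((A t).card : ℝ)) ≤ Fintype.card G := by
  -- notation
  set S : ℝ := ∑ t, ((A t).card : ℝ) with hS
  let c : T → R → G → ℝ := fun t r x => ∑ y ∈ A t, ν t r (x - y)
  let Φ : R → G → ℝ := fun r x => ∑ t, c t r x
  let M : T → T → ℝ := fun t u => ∑ r, ∑ x, c t r x * c u r x
  -- (a) the total mass of each block convolution
  have hc_sum : ∀ t r, ∑ x, c t r x = ((A t).card : ℝ) * e r := by
    intro t r
    show ∑ x, ∑ y ∈ A t, ν t r (x - y) = _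
    rw [Finset.sum_comm]
    have : ∀ y ∈ A t, ∑ x, ν t r (x - y) = e r := fun y _ => by
      rw [sum_sub_right_eq (ν t r) y, h1]
    rw [Finset.sum_congr rfl this, Finset.sum_const, nsmul_eq_mul]
  have hΦ_sum : ∀ r, ∑ x, Φ r x = S * e r := by
    intro r
    show ∑ x, ∑ t, c t r x = _
    rw [Finset.sum_comm, hS, Finset.sum_mul]
    exact Finset.sum_congr rfl fun t _ => hc_sum t r
  -- (b) Cauchy–Schwarz: S² ≤ |G| Σ_r Σ_x Φ²
  have hCS : S ^ 2 ≤ (Fintype.card G : ℝ) * ∑ r, ∑ x, Φ r x ^ 2 := by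
    calc S ^ 2 = ∑ r, (S * e r) ^ 2 := by
            simp_rw [mul_pow]; rw [← Finset.mul_sum, he, mul_one]
      _ = ∑ r, (∑ x, Φ r x) ^ 2 := by simp_rw [hΦ_sum]
      _ ≤ ∑ r, (Fintype.card G : ℝ) * ∑ x, Φ r x ^ 2 := by
            refine Finset.sum_le_sum fun r _ => ?_
            have h := sq_sum_le_card_mul_sum_sq (s := (Finset.univ : Finset G)) (f := fun x => Φ r x)
            simpa [Finset.card_univ] using h
      _ = (Fintype.card G : ℝ) * ∑ r, ∑ x, Φ r x ^ 2 := by rw [Finset.mul_sum]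
  -- (c) expansion of the square into block pairs
  have hexp : ∑ r, ∑ x, Φ r x ^ 2 = ∑ t, ∑ u, M t u := by
    show ∑ r, ∑ x, (∑ t, c t r x) ^ 2 = ∑ t, ∑ u, ∑ r, ∑ x, c t r x * c u r x
    have : ∀ r x, (∑ t, c t r x) ^ 2 = ∑ t, ∑ u, c t r x * c u r x := fun r x => by
      rw [sq, Finset.sum_mul_sum]
    simp_rw [this]
    exact Literature.Computability.QuantumComplexity.CHHL2018.sum_comm4 _ _ _ _ (fun r x t u => c t r x * c u r x)
  -- (d) diagonal blocks: contraction
  have hdiag : ∀ t, M t t ≤ ((A t).card : ℝ) := by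
    intro t
    have hsq : M t t = ∑ r, ∑ x, (∑ y ∈ A t, ν t r (x - y)) ^ 2 := by
      show ∑ r, ∑ x, c t r x * c t r x = _
      simp_rw [← sq]
      rfl
    rw [hsq]; exact h2 t
  -- (e) off-diagonal blocks: non-positive correlation
  have hoff : ∀ t u, t ≠ u → M t u ≤ 0 := by
    intro t u htu
    have hrw : M t u = ∑ y ∈ A t, ∑ y' ∈ A u, ∑ r, ∑ x, ν t r (x - y) * ν u r (x - y') := by
      show ∑ r, ∑ x, (∑ y ∈ A t, ν t r (x - y)) * (∑ y' ∈ A u, ν u r (x - y')) = _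
      simp_rw [Finset.sum_mul_sum]
      exact Literature.Computability.QuantumComplexity.CHHL2018.sum_comm4 _ _ _ _
        (fun r x y y' => ν t r (x - y) * ν u r (x - y'))
    rw [hrw]
    refine Finset.sum_nonpos fun y hy => Finset.sum_nonpos fun y' hy' => ?_
    have hshift : ∀ r, ∑ x, ν t r (x - y) * ν u r (x - y') = ∑ w, ν t r w * ν u r (w + (y - y')) := by
      intro r
      refine Fintype.sum_equiv (Equiv.subRight y) _ _ fun x => ?_
      show ν t r (x - y) * ν u r (x - y') = ν t r (x - y) * ν u r (x - y + (y - y'))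
      rw [sub_add_sub_cancel]
    simp_rw [hshift]
    exact h3 t u htu y hy y' hy'
  -- (f) assemble: Σ_t Σ_u M t u ≤ S
  have hM : ∀ t u, M t u ≤ if u = t then ((A t).card : ℝ) else 0 := by
    intro t u
    split_ifs with h
    · subst h; exact hdiag u
    · exact hoff t u (fun h' => h h'.symm)
  have hsumM : ∑ t, ∑ u, M t u ≤ S := by
    calc ∑ t, ∑ u, M t u ≤ ∑ t, ∑ u, (if u = t then ((A t).card : ℝ) else 0) :=
            Finset.sum_le_sum fun t _ => Finset.sum_le_sum fun u _ => hM t u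
      _ = ∑ t, ((A t).card : ℝ) := by
            refine Finset.sum_congr rfl fun t _ => ?_
            rw [Finset.sum_ite_eq' Finset.univ t]; simp
      _ = S := rfl
  -- (g) S² ≤ |G| S  ⇒  S ≤ |G|
  have hS2 : S ^ 2 ≤ (Fintype.card G : ℝ) * S := by
    calc S ^ 2 ≤ (Fintype.card G : ℝ) * ∑ r, ∑ x, Φ r x ^ 2 := hCS
      _ = (Fintype.card G : ℝ) * ∑ t, ∑ u, M t u := by rw [hexp]
      _ ≤ (Fintype.card G : ℝ) * S := by
            exact mul_le_mul_of_nonneg_left hsumM (Nat.cast_nonneg _)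
  have hS0 : 0 ≤ S := Finset.sum_nonneg fun t _ => Nat.cast_nonneg _
  have hG0 : (0 : ℝ) ≤ Fintype.card G := Nat.cast_nonneg _
  by_contra hlt
  rw [not_le] at hlt
  have hpos : 0 < S := lt_of_le_of_lt hG0 hlt
  have : (Fintype.card G : ℝ) * S < S * S := mul_lt_mul_of_pos_right hlt hpos
  nlinarith [hS2, this]

/-- The one-coordinate (scalar) form: a single real stencil per block. -/
theorem sum_card_le_card_of_scalar_stencils (A : T → Finset G) (ν : T → G → ℝ)
    (h1 : ∀ t, ∑ z, ν t z = 1)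
    (h2 : ∀ t, ∑ x, (∑ y ∈ A t, ν t (x - y)) ^ 2 ≤ ((A t).card : ℝ))
    (h3 : ∀ t u, t ≠ u → ∀ y ∈ A t, ∀ y' ∈ A u, ∑ w, ν t w * ν u (w + (y - y')) ≤ 0) :
    (∑ t, ((A t).card : ℝ)) ≤ Fintype.card G := by
  refine sum_card_le_card_of_stencils (R := Unit) A (fun t _ => ν t) (fun _ => 1) (by simp)
    (fun t _ => h1 t) (fun t => by simpa using h2 t) (fun t u htu y hy y' hy' => by simpa using h3 t u htu y hy y' hy')

/-- Translate packings are scalar stencils: point masses `ν t = δ_{σ t}`.  If the translates `A_t + σ_t` are pairwise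
disjoint then `Σ |A_t| ≤ |G|` — recovered from the certificate (hypothesis (3) is exactly disjointness). -/
theorem sum_card_le_card_of_disjoint_translates (A : T → Finset G) (σ : T → G)
    (hdis : ∀ t u, t ≠ u → ∀ y ∈ A t, ∀ y' ∈ A u, y + σ t ≠ y' + σ u) :
    (∑ t, ((A t).card : ℝ)) ≤ Fintype.card G := by
  classical
  refine sum_card_le_card_of_scalar_stencils A (fun t z => if z = σ t then 1 else 0) ?_ ?_ ?_
  · intro t; simp
  · intro t
    -- (Σ_{y ∈ A_t} [x - y = σ_t])² = [x - σ_t ∈ A_t], and Σ_x [x - σ_t ∈ A_t] = |A_t|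
    have hpt : ∀ x, (∑ y ∈ A t, (if x - y = σ t then (1 : ℝ) else 0)) = if x - σ t ∈ A t then 1 else 0 := by
      intro x
      have : ∀ y ∈ A t, (if x - y = σ t then (1 : ℝ) else 0) = if y = x - σ t then 1 else 0 := by
        intro y _; congr 1; apply propext
        constructor
        · intro h; rw [← h]; abel
        · intro h; rw [h]; abel
      rw [Finset.sum_congr rfl this, Finset.sum_ite_eq' (A t) (x - σ t)]
    simp_rw [hpt]
    have hsq : ∀ x, (if x - σ t ∈ A t then (1 : ℝ) else 0) ^ 2 = if x - σ t ∈ A t then 1 else 0 := by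
      intro x; split_ifs <;> simp
    simp_rw [hsq]
    rw [sum_sub_right_eq (fun z => if z ∈ A t then (1 : ℝ) else 0) (σ t)]
    simp
  · intro t u htu y hy y' hy'
    refine Finset.sum_nonpos fun w _ => ?_
    by_cases hw : w = σ t
    · subst hw
      have : σ t + (y - y') ≠ σ u := by
        intro h; apply hdis t u htu y hy y' hy'
        rw [← h]; abel
      simp [this]
    · simp [hw]

end Stencil

end Summit.MatrixMultiplication.MatrixMultiplication.Theorems.SoloVal
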